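import Summits.Ventures.HodgeRepro2.T5SU11JacobiTransform
import Summits.Ventures.HodgeRepro2.T5SU11SphericalMajorant
import Summits.Ventures.HodgeRepro2.T5BergmanCoefficientLpAll

/-!
# The Herz–Cowling–Haagerup–Howe majorant for EVERY `K`-finite coefficient of the weight-`k`
discrete series: `|⟨π_k(g) zᵐ, zⁿ⟩_k| ≤ C_{m,n} ⟨zⁿ,zⁿ⟩_k · Ξ(g)`, and its spherical-transform consequence

`T5BergmanKTypeMatrix` bounds every `K`-finite matrix coefficient of the weight-`k` representation by
`C_{m,n} ⟨zⁿ,zⁿ⟩_k |a(g)|^{-k}` (`norm_matrixCoeff_monomial_monomial_le`), and `T5SU11SphericalMajorant`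
bounds `|a(g)|^{-s}` by Harish-Chandra's `Ξ(g) = φ_1(g)` for `s ≥ 1` (`norm_mat_inv_rpow_le_sph_one`).
Composing: **`|⟨π_k(g) zᵐ, zⁿ⟩_k| ≤ C_{m,n} ⟨zⁿ,zⁿ⟩_k · Ξ(g)`** for every `k ≥ 2` and all `m, n`
(`norm_matrixCoeff_le_sph_one`) — the Herz / Cowling–Haagerup–Howe majorant principle for the `K`-finite
vectors of the explicit model, with explicit constants, in kernel — and `≤ C_{m,n} ⟨zⁿ,zⁿ⟩_k · φ_λ(g)` for
every `λ` (`norm_matrixCoeff_le_sph`). Since `|a(g)|^{-k} = (1 − |g·0|²)^{k/2} = m_k(g)`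
(`norm_matrixCoeff_le_orbit_rpow`), the spherical transform of `T5SU11JacobiTransform` dominates the
spherical integrals of every coefficient: for `k ≥ 3`, `λ < k`, `k + λ > 2`,
`|⟨π_k(·) zᵐ, zⁿ⟩_k| · φ_λ ∈ L¹(ν)` (`integrable_norm_matrixCoeff_mul_sph`,
`integrable_matrixCoeff_mul_sph`) with
**`∫_G |⟨π_k(g) zᵐ, zⁿ⟩_k| φ_λ(g) dν ≤ C_{m,n} ⟨zⁿ,zⁿ⟩_k · 2^{k−2} √π Γ((k−1)/2)/Γ(k/2) · Γ((k−λ)/2) Γ((k+λ)/2 − 1)/Γ(k−1)`**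
(`integral_norm_matrixCoeff_mul_sph_le`); in particular every coefficient of `π₃⁺` (`k = 3`) is
`Ξ`-integrable (`integrable_norm_matrixCoeff_mul_sph_one`). Nothing is claimed about (N).

Blind lane: Mathlib + the HodgeRepro2 prefix only; no sorry; axioms ⊆ {propext, Classical.choice,
Quot.sound}.
-/

namespace Summit.Ventures.HodgeRepro2.T5SU11KFiniteMajorant

open MeasureTheory MeasureTheory.Measure Metric Set Filter Topology Complex
open T5SU11Unimodular T5SU11Fibration T5SU11Cartan T5SU11OneParameter T5SU11CartanProjection
  T5HaarCircle T5BergmanCoefficient T5SU11FibrationHaar T5SU11IwasawaProjection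
  T5BergmanMatrixCoeff T5BergmanKTypeMatrix T5BergmanParseval T5BergmanCoefficientLpAll
  T5SU11SphericalFunction
  T5SU11SphericalBounds T5SU11SphericalContinuous T5SU11SphericalMajorant T5SU11JacobiIwasawa
  T5SU11JacobiTransform
open scoped Real

/-! ### The coefficient modulus dominates every `K`-finite coefficient -/

/-- `|a(g)|^{-k} = (1 − |g·0|²)^{k/2}` (natural `k`). -/
lemma norm_mat_inv_pow_eq_orbit_rpow (k : ℕ) (g : SU11) :
    ‖mat g 0 0‖⁻¹ ^ k = (1 - ‖orbit g‖ ^ 2) ^ ((k : ℝ) / 2) := by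
  rw [one_sub_norm_orbit_sq, ← Real.rpow_two, ← Real.rpow_mul (inv_nonneg.mpr (norm_nonneg _)),
    show (2 : ℝ) * ((k : ℝ) / 2) = (k : ℝ) by ring, Real.rpow_natCast]

/-- **Every `K`-finite coefficient is dominated by the lowest-weight coefficient modulus**:
`|⟨π_k(g) zᵐ, zⁿ⟩_k| ≤ C_{m,n} ⟨zⁿ,zⁿ⟩_k · (1 − |g·0|²)^{k/2}` for `k ≥ 2`. -/
theorem norm_matrixCoeff_le_orbit_rpow (k : ℕ) (hk : 2 ≤ k) (g : SU11) (m n : ℕ) :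
    ‖matrixCoeff k (fun z => z ^ m) (fun z => z ^ n) g‖ ≤
      decayConst k m n * monomialNormSq k n * (1 - ‖orbit g‖ ^ 2) ^ ((k : ℝ) / 2) := by
  rw [← norm_mat_inv_pow_eq_orbit_rpow]
  exact norm_matrixCoeff_monomial_monomial_le k hk g m n

/-! ### Continuity and the spherical integrals of the coefficients -/

/-- Every `K`-finite coefficient `g ↦ ⟨π_k(g) zᵐ, zⁿ⟩_k` is continuous. -/
theorem continuous_matrixCoeff_monomial_monomial (k m n : ℕ) :
    Continuous (matrixCoeff k (fun z => z ^ m) (fun z => z ^ n)) := by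
  refine continuous_matrixCoeff_of_bounded k _ _ (continuousOn_pow m) (continuousOn_pow n)
    (Mf := 1) (Mh := 1) (fun w hw => ?_) (fun w hw => ?_)
  · rw [norm_pow]
    exact pow_le_one₀ (norm_nonneg _) (mem_ball_zero_iff.mp hw).le
  · rw [norm_pow]
    exact pow_le_one₀ (norm_nonneg _) (mem_ball_zero_iff.mp hw).le

section measure

variable [MeasurableSpace Circle] [BorelSpace Circle]

/-! ### The Herz–Cowling–Haagerup–Howe majorant -/

/-- **THE HERZ–COWLING–HAAGERUP–HOWE MAJORANT FOR EVERY `K`-FINITE COEFFICIENT**: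
`|⟨π_k(g) zᵐ, zⁿ⟩_k| ≤ C_{m,n} ⟨zⁿ,zⁿ⟩_k · Ξ(g)` for every `k ≥ 2`, all `m, n` and all `g`. -/
theorem norm_matrixCoeff_le_sph_one (k : ℕ) (hk : 2 ≤ k) (g : SU11) (m n : ℕ) :
    ‖matrixCoeff k (fun z => z ^ m) (fun z => z ^ n) g‖ ≤
      decayConst k m n * monomialNormSq k n * sph 1 g := by
  refine (norm_matrixCoeff_monomial_monomial_le k hk g m n).trans ?_
  have hC : 0 ≤ decayConst k m n * monomialNormSq k n :=
    mul_nonneg (decayConst_nonneg k m n) (monomialNormSq_pos k n).le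
  refine mul_le_mul_of_nonneg_left ?_ hC
  rw [← Real.rpow_natCast]
  have h1 : (1 : ℝ) ≤ (k : ℝ) := by exact_mod_cast (show 1 ≤ k by omega)
  exact norm_mat_inv_rpow_le_sph_one h1 g

/-- The majorant by every spherical function: `|⟨π_k(g) zᵐ, zⁿ⟩_k| ≤ C_{m,n} ⟨zⁿ,zⁿ⟩_k · φ_λ(g)`
(`Ξ ≤ φ_λ`). -/
theorem norm_matrixCoeff_le_sph (k : ℕ) (hk : 2 ≤ k) (lam : ℝ) (g : SU11) (m n : ℕ) :
    ‖matrixCoeff k (fun z => z ^ m) (fun z => z ^ n) g‖ ≤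
      decayConst k m n * monomialNormSq k n * sph lam g := by
  refine (norm_matrixCoeff_le_sph_one k hk g m n).trans ?_
  have hC : 0 ≤ decayConst k m n * monomialNormSq k n :=
    mul_nonneg (decayConst_nonneg k m n) (monomialNormSq_pos k n).le
  exact mul_le_mul_of_nonneg_left (sph_one_le lam g) hC

/-- **`|⟨π_k(·) zᵐ, zⁿ⟩_k| · φ_λ ∈ L¹(ν)`** for `k ≥ 3`, `λ < k`, `k + λ > 2` (dominated by
`C_{m,n} ⟨zⁿ,zⁿ⟩_k · m_k φ_λ`, integrable by `T5SU11JacobiTransform`). -/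
theorem integrable_norm_matrixCoeff_mul_sph {k : ℕ} (hk : 3 ≤ k) {lam : ℝ} (h1 : lam < k)
    (h2 : 2 < k + lam) (m n : ℕ) :
    Integrable (fun g => ‖matrixCoeff k (fun z => z ^ m) (fun z => z ^ n) g‖ * sph lam g)
      (nu haarCircle) := by
  have hk2 : 2 ≤ k := by omega
  have hk1 : (1 : ℝ) < k := by exact_mod_cast (show 1 < k by omega)
  have hdom := (integrable_orbit_rpow_mul_sph hk1 h1 h2).const_mul
    (decayConst k m n * monomialNormSq k n)
  refine hdom.mono' ?_ (Filter.Eventually.of_forall fun g => ?_)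
  · exact ((continuous_matrixCoeff_monomial_monomial k m n).norm.mul (continuous_sph lam))
      |>.aestronglyMeasurable
  · rw [Real.norm_eq_abs, abs_of_nonneg (mul_nonneg (norm_nonneg _) (sph_pos lam g).le),
      ← mul_assoc]
    exact mul_le_mul_of_nonneg_right (norm_matrixCoeff_le_orbit_rpow k hk2 g m n) (sph_pos lam g).le

/-- **The coefficient times a spherical function is integrable**: `⟨π_k(·) zᵐ, zⁿ⟩_k · φ_λ ∈ L¹(ν, ℂ)`
for `k ≥ 3`, `λ < k`, `k + λ > 2`. -/
theorem integrable_matrixCoeff_mul_sph {k : ℕ} (hk : 3 ≤ k) {lam : ℝ} (h1 : lam < k)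
    (h2 : 2 < k + lam) (m n : ℕ) :
    Integrable (fun g => matrixCoeff k (fun z => z ^ m) (fun z => z ^ n) g * (sph lam g : ℂ))
      (nu haarCircle) := by
  refine (integrable_norm_matrixCoeff_mul_sph hk h1 h2 m n).mono' ?_
    (Filter.Eventually.of_forall fun g => ?_)
  · exact ((continuous_matrixCoeff_monomial_monomial k m n).mul
      (Complex.continuous_ofReal.comp (continuous_sph lam))).aestronglyMeasurable
  · rw [norm_mul, Complex.norm_real, Real.norm_eq_abs, abs_of_pos (sph_pos lam g)]

/-- **The spherical integral of every `K`-finite coefficient is bounded by the transform of `m_k`**: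
`∫_G |⟨π_k(g) zᵐ, zⁿ⟩_k| φ_λ(g) dν ≤ C_{m,n} ⟨zⁿ,zⁿ⟩_k · 2^{k−2} √π Γ((k−1)/2)/Γ(k/2) · Γ((k−λ)/2) Γ((k+λ)/2 − 1)/Γ(k−1)`
for `k ≥ 3`, `λ < k`, `k + λ > 2`. -/
theorem integral_norm_matrixCoeff_mul_sph_le {k : ℕ} (hk : 3 ≤ k) {lam : ℝ} (h1 : lam < k)
    (h2 : 2 < k + lam) (m n : ℕ) :
    ∫ g, ‖matrixCoeff k (fun z => z ^ m) (fun z => z ^ n) g‖ * sph lam g ∂(nu haarCircle) ≤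
      decayConst k m n * monomialNormSq k n
        * (2 ^ ((k : ℝ) - 2) * (√π * Real.Gamma (((k : ℝ) - 1) / 2) / Real.Gamma ((k : ℝ) / 2))
          * (Real.Gamma (((k : ℝ) - lam) / 2) * Real.Gamma (((k : ℝ) + lam) / 2 - 1)
            / Real.Gamma ((k : ℝ) - 1))) := by
  have hk2 : 2 ≤ k := by omega
  have hk1 : (1 : ℝ) < k := by exact_mod_cast (show 1 < k by omega)
  rw [← integral_orbit_rpow_mul_sph hk1 h1 h2, ← integral_const_mul]
  refine integral_mono (integrable_norm_matrixCoeff_mul_sph hk h1 h2 m n)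
    ((integrable_orbit_rpow_mul_sph hk1 h1 h2).const_mul _) fun g => ?_
  simp only
  rw [← mul_assoc]
  exact mul_le_mul_of_nonneg_right (norm_matrixCoeff_le_orbit_rpow k hk2 g m n) (sph_pos lam g).le

/-- **Every coefficient of `π₃⁺` is `Ξ`-integrable**: `|⟨π_3(·) zᵐ, zⁿ⟩_3| · Ξ ∈ L¹(ν)`. -/
theorem integrable_norm_matrixCoeff_mul_sph_one (m n : ℕ) :
    Integrable (fun g => ‖matrixCoeff 3 (fun z => z ^ m) (fun z => z ^ n) g‖ * sph 1 g)
      (nu haarCircle) :=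
  integrable_norm_matrixCoeff_mul_sph (le_refl 3) (by norm_num) (by norm_num) m n

end measure

end Summit.Ventures.HodgeRepro2.T5SU11KFiniteMajorant
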